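import Summits.Ventures.WeilGRH.KeyMarkovForm
import Summits.Ventures.WeilGRH.TwistedWindowGram
import Summits.Ventures.WeilGRH.TwistedGramEvenComplex
import HarnessLib

/-!
# GRH arm (rh-explicit, venture WeilGRH): the sesquilinear Markov window form of a KEY, its Gram expansion,
  and the affinity of the Gram family in the data («`S(z) = S₀ − Σ_n (Λ(n)/√n)(z_n P_n + z̄_n P_n^*)`»)

Cell `rh-explicit`, WEIL TRACK — GRH ARM (lit/typing seat weil-grh-5; step (ii) of the bridge plan GRH-LIT-AS-PRINTED
A27, SECTION language as fixed by weil-grh-4 gen7).  Sequel of `KeyMarkovForm.lean` (the Markov window form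
`keyMarkovForm a L v b u` of a key `(a, L, v)`, defined on every window function) and the data-indexed analogue of
weil-grh-1's `TwistedWindowGram.lean` (`twistedWindowSesq χ a u v`).

* `keyWindowSesq a L v b u w` — polarisation of `keyMarkovForm a L v b` (twisted sesquilinear prime increments
  `D^{v̄(n)}_{log n}(u, w)` weighted by `Λ(n)n^{-1/2}`, parity-`a` archimedean density, `−M_{a,L,v,b} ∫ u conj w`); for
  `(a, L, v) = (a_χ, log q, χ)` it IS `twistedWindowSesq χ b` (`twistedWindowSesq_eq_key`, `rfl`); diagonal =
  `keyMarkovForm` (`keyWindowSesq_self`); hermitian, linear in `u` over window functions, affine in the level `L`;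
* **the Gram expansion** `keyMarkovForm_sum_smul` / `keyMarkovForm_sum_smul_chi` on Yoshida's trigonometric windows
  `χ_n = (2b)^{-1/2}e^{iπnx/b}𝟙_{[-b,b]}` — the finite SECTIONS of the arm's certificates (C–C / `lfun_weilmat` /
  `fsm_eig_chi` basis = the `χ_n` after real recombination);
* **affinity of the sesquilinear form in the data** (`keyWindowSesq_sub_eq`): through the polarised twisted increment
  `D^{ω̄}_t(u, w) = (1 + |ω|²)⟨u, w⟩ − ω P_t(u, w) − ω̄ conj P_t(w, u)`, `P_t(u, w) = ∫ u(x+t) conj w(x) dx`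
  (`weilTwistIncrementSesq_conj_of_isWindowFunction`), the `|v(n)|²` terms cancel against the killing constant and
  `S_v(u, w) − S_{v'}(u, w) = −Σ_{log n<2b} Λ(n)n^{-1/2}[(v − v')(n) P_{log n}(u, w) + conj((v − v')(n)) conj P_{log n}(w, u)]`;
* **Gram affinity on the section** (`keyWindowSesq_chi_sub_eq`): with the tree's closed-form shift pairing
  `shiftCoeff b t m n = ∫ χ_m(x+t) conj χ_n(x) dx` (`TwistedGramEvenComplex.lean`),
  `G_v(m, n) − G_{v'}(m, n) = −Σ_k Λ(k)k^{-1/2}[(v − v')(k)·P_{log k}(m, n) + conj((v − v')(k)·P_{log k}(n, m))]` — the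
  hermitian matrix family `z ↦ S(z)` of weil-grh-4's single-state certificates (GRH/STRUCTURE §16(f), §17) is AFFINE in
  the data with matrix coefficients the shift pairings at the visible prime-power lengths.

Everything is proved; one definition; no named facts; RH/GRH-free.  Not here: the section one-vector principle (step
(iii)) and instance data.  Sources: Weil 1952 (11) pp. 261–262 (the prime term is linear in `χ`)
[Weil1952FormulesExplicites]; Bombieri 2000 Thm 2 p. 193 (the form through increments) [Bombieri2000Weil]; Yoshida 1992
§5 (5.13)–(5.16) (the basis `χ_n`, Gram matrices) [Yoshida1992].
-/

set_option autoImplicit false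

noncomputable section

open Complex Filter Set MeasureTheory
open scoped Real Topology ComplexConjugate ArithmeticFunction.vonMangoldt

namespace Summit.Ventures.WeilGRH

open Literature.NumberTheory.LFunctions
open Literature.NumberTheory.LFunctions.Yoshida1992 (modes chi)
open Summit.RiemannHypothesis.RiemannHypothesis.Theorems.WeilFormatC

variable {q : ℕ} {b : ℝ} {u w u₁ u₂ : ℝ → ℂ}

/-! ## Definition and dictionary -/

/-- The **sesquilinear Markov window form of the key** `(a, L, v)` on `[-b, b]`:
`S_{a,L,v,b}(u, w) = Σ_{log n < 2b} Λ(n) n^{-1/2} D^{v̄(n)}_{log n}(u, w) + ∫₀^∞ ρ_a(t) D_t(u, w) dt − M_{a,L,v,b} ∫ u conj w`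
— the polarisation of `keyMarkovForm a L v b` (`keyWindowSesq_self`), i.e. weil-grh-1's `twistedWindowSesq χ b` with
`(charParity χ, log q, χ(n))` replaced by abstract key data `(a, L, v(n))` (`twistedWindowSesq_eq_key`).  Linear in
`u`, conjugate-linear in `w`; its matrix on Yoshida's windows `χ_n` is the section Gram matrix `S(v)` of the arm's
key certificates. [cite: Bombieri2000Weil, Thm 2 (p. 193); Yoshida1992, §5 (5.13)–(5.16)] -/
def keyWindowSesq (a : ℕ) (L : ℝ) (v : ℕ → ℂ) (b : ℝ) (u w : ℝ → ℂ) : ℂ :=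
  (∑ n ∈ weilPrimeIndex b, ((Λ n : ℝ) / Real.sqrt n : ℂ) *
      weilTwistIncrementSesq (conj (v n)) u w (Real.log n)) +
    (∫ t in Ioi (0 : ℝ), (weilArchDensityPar a t : ℂ) * weilIncrementSesq u w t) -
    (keyMarkovConstant a L v b : ℂ) * ∫ x : ℝ, u x * conj (w x)

/-- **Dictionary**: the `χ`-twisted sesquilinear window form IS the key form at `(a_χ, log q, χ)`. [folklore] -/
theorem twistedWindowSesq_eq_key (χ : DirichletCharacter ℂ q) (b : ℝ) (u w : ℝ → ℂ) :
    twistedWindowSesq χ b u w = keyWindowSesq (charParity χ) (Real.log q) (fun n ↦ χ (n : ZMod q)) b u w := rfl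

/-- `∫ u conj u = ‖u‖₂²` as a cast real. -/
private theorem integral_mul_conj_self (u : ℝ → ℂ) :
    ∫ x : ℝ, u x * conj (u x) = ((∫ x : ℝ, ‖u x‖ ^ 2 : ℝ) : ℂ) := by
  rw [← integral_complex_ofReal]
  exact integral_congr_ae (Eventually.of_forall fun x ↦ by
    beta_reduce; rw [Complex.mul_conj, Complex.normSq_eq_norm_sq])

/-- **The diagonal is the Markov key form**: `keyWindowSesq a L v b u u = keyMarkovForm a L v b u` (no hypothesis
on `u`). [folklore] -/
theorem keyWindowSesq_self (a : ℕ) (L : ℝ) (v : ℕ → ℂ) (b : ℝ) (u : ℝ → ℂ) :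
    keyWindowSesq a L v b u u = ((keyMarkovForm a L v b u : ℝ) : ℂ) := by
  unfold keyWindowSesq keyMarkovForm keyDirichletEnergy
  simp_rw [weilTwistIncrementSesq_self, weilIncrementSesq_self]
  have harch : ∫ t in Ioi (0 : ℝ), (weilArchDensityPar a t : ℂ) * (weilIncrement u t : ℂ) =
      ((∫ t in Ioi (0 : ℝ), weilArchDensityPar a t * weilIncrement u t : ℝ) : ℂ) := by
    rw [← integral_complex_ofReal]
    exact integral_congr_ae (Eventually.of_forall fun t ↦ by push_cast; rfl)
  rw [harch, integral_mul_conj_self]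
  push_cast
  ring

/-- **Hermitian symmetry**: `keyWindowSesq a L v b w u = conj (keyWindowSesq a L v b u w)`. [folklore] -/
theorem keyWindowSesq_conj_symm (a : ℕ) (L : ℝ) (v : ℕ → ℂ) (b : ℝ) (u w : ℝ → ℂ) :
    keyWindowSesq a L v b w u = conj (keyWindowSesq a L v b u w) := by
  have hdiv : ∀ n : ℕ, conj (((Λ n : ℝ) / Real.sqrt n : ℂ)) = ((Λ n : ℝ) / Real.sqrt n : ℂ) := by
    intro n
    rw [map_div₀, Complex.conj_ofReal, Complex.conj_ofReal]
  have hsum : ∑ n ∈ weilPrimeIndex b, ((Λ n : ℝ) / Real.sqrt n : ℂ) *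
      weilTwistIncrementSesq (conj (v n)) w u (Real.log n) =
      conj (∑ n ∈ weilPrimeIndex b, ((Λ n : ℝ) / Real.sqrt n : ℂ) *
        weilTwistIncrementSesq (conj (v n)) u w (Real.log n)) := by
    rw [map_sum]
    refine Finset.sum_congr rfl fun n _ ↦ ?_
    rw [map_mul, hdiv, weilTwistIncrementSesq_conj_symm]
  have harch : ∫ t in Ioi (0 : ℝ), (weilArchDensityPar a t : ℂ) * weilIncrementSesq w u t =
      conj (∫ t in Ioi (0 : ℝ), (weilArchDensityPar a t : ℂ) * weilIncrementSesq u w t) := by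
    rw [← integral_conj]
    refine integral_congr_ae (Eventually.of_forall fun t ↦ ?_)
    beta_reduce
    rw [map_mul, Complex.conj_ofReal, weilIncrementSesq_conj_symm]
  have hinner : ∫ x : ℝ, w x * conj (u x) = conj (∫ x : ℝ, u x * conj (w x)) := by
    rw [← integral_conj]
    refine integral_congr_ae (Eventually.of_forall fun x ↦ ?_)
    simp only [map_mul, Complex.conj_conj]
    ring
  unfold keyWindowSesq
  rw [hsum, harch, hinner]
  simp only [map_add, map_sub, map_mul, Complex.conj_ofReal]

/-- **Homogeneity**: `keyWindowSesq a L v b (c • u) w = c · keyWindowSesq a L v b u w`. [folklore] -/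
theorem keyWindowSesq_smul_left (a : ℕ) (L : ℝ) (v : ℕ → ℂ) (b : ℝ) (c : ℂ) (u w : ℝ → ℂ) :
    keyWindowSesq a L v b (c • u) w = c * keyWindowSesq a L v b u w := by
  unfold keyWindowSesq
  simp_rw [weilTwistIncrementSesq_smul_left, weilIncrementSesq_smul_left]
  have harch : ∫ t in Ioi (0 : ℝ), (weilArchDensityPar a t : ℂ) * (c * weilIncrementSesq u w t) =
      c * ∫ t in Ioi (0 : ℝ), (weilArchDensityPar a t : ℂ) * weilIncrementSesq u w t := by
    rw [← integral_const_mul]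
    exact integral_congr_ae (Eventually.of_forall fun t ↦ by ring)
  have hinner : ∫ x : ℝ, (c • u) x * conj (w x) = c * ∫ x : ℝ, u x * conj (w x) := by
    rw [← integral_const_mul]
    refine integral_congr_ae (Eventually.of_forall fun x ↦ ?_)
    simp only [Pi.smul_apply, smul_eq_mul, mul_assoc]
  have hsum : ∑ n ∈ weilPrimeIndex b, ((Λ n : ℝ) / Real.sqrt n : ℂ) *
      (c * weilTwistIncrementSesq (conj (v n)) u w (Real.log n)) =
      c * ∑ n ∈ weilPrimeIndex b, ((Λ n : ℝ) / Real.sqrt n : ℂ) *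
        weilTwistIncrementSesq (conj (v n)) u w (Real.log n) := by
    rw [Finset.mul_sum]
    exact Finset.sum_congr rfl fun n _ ↦ by ring
  rw [harch, hinner, hsum]
  ring

/-- **Additivity in the first argument** for window functions on `[-b, b]`, `b ≥ 0`. [folklore] -/
theorem keyWindowSesq_add_left (hb : 0 ≤ b) (hu₁ : IsWindowFunction b u₁) (hu₂ : IsWindowFunction b u₂)
    (hw : IsWindowFunction b w) (a : ℕ) (L : ℝ) (v : ℕ → ℂ) :
    keyWindowSesq a L v b (u₁ + u₂) w = keyWindowSesq a L v b u₁ w + keyWindowSesq a L v b u₂ w := by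
  unfold keyWindowSesq
  simp_rw [weilTwistIncrementSesq_add_left hu₁ hu₂ hw, weilIncrementSesq_add_left hu₁ hu₂ hw]
  have harch : ∫ t in Ioi (0 : ℝ), (weilArchDensityPar a t : ℂ) *
      (weilIncrementSesq u₁ w t + weilIncrementSesq u₂ w t) =
      (∫ t in Ioi (0 : ℝ), (weilArchDensityPar a t : ℂ) * weilIncrementSesq u₁ w t) +
        ∫ t in Ioi (0 : ℝ), (weilArchDensityPar a t : ℂ) * weilIncrementSesq u₂ w t := by
    rw [← integral_add (integrableOn_weilArchDensityPar_mul_weilIncrementSesq hb hu₁ hw _)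
      (integrableOn_weilArchDensityPar_mul_weilIncrementSesq hb hu₂ hw _)]
    exact integral_congr_ae (Eventually.of_forall fun t ↦ mul_add _ _ _)
  have hinner : ∫ x : ℝ, (u₁ + u₂) x * conj (w x) =
      (∫ x : ℝ, u₁ x * conj (w x)) + ∫ x : ℝ, u₂ x * conj (w x) := by
    rw [← integral_add (hu₁.integrable_mul_conj hw) (hu₂.integrable_mul_conj hw)]
    exact integral_congr_ae (Eventually.of_forall fun x ↦ by simp only [Pi.add_apply, add_mul])
  have hsum : ∑ n ∈ weilPrimeIndex b, ((Λ n : ℝ) / Real.sqrt n : ℂ) *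
      (weilTwistIncrementSesq (conj (v n)) u₁ w (Real.log n) +
        weilTwistIncrementSesq (conj (v n)) u₂ w (Real.log n)) =
      (∑ n ∈ weilPrimeIndex b, ((Λ n : ℝ) / Real.sqrt n : ℂ) *
        weilTwistIncrementSesq (conj (v n)) u₁ w (Real.log n)) +
        ∑ n ∈ weilPrimeIndex b, ((Λ n : ℝ) / Real.sqrt n : ℂ) *
          weilTwistIncrementSesq (conj (v n)) u₂ w (Real.log n) := by
    rw [← Finset.sum_add_distrib]
    exact Finset.sum_congr rfl fun n _ ↦ mul_add _ _ _
  rw [harch, hinner, hsum]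
  ring

/-- **Affinity in the level**: `keyWindowSesq a L' v b u w = keyWindowSesq a L v b u w + (L' − L) ∫ u conj w`
(the polarisation of `keyMarkovForm_eq_add_norm`). [folklore] -/
theorem keyWindowSesq_eq_add_inner (a : ℕ) (L L' : ℝ) (v : ℕ → ℂ) (b : ℝ) (u w : ℝ → ℂ) :
    keyWindowSesq a L' v b u w = keyWindowSesq a L v b u w + ((L' - L : ℝ) : ℂ) * ∫ x : ℝ, u x * conj (w x) := by
  unfold keyWindowSesq keyMarkovConstant
  push_cast
  ring

/-! ## Finite linear combinations and the Gram expansion -/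

/-- Linearity in the first argument over finite sums of window functions (`b ≥ 0`). [folklore] -/
theorem keyWindowSesq_sum_left (hb : 0 ≤ b) {ι : Type*} (s : Finset ι) {f : ι → ℝ → ℂ}
    (hf : ∀ i ∈ s, IsWindowFunction b (f i)) (hw : IsWindowFunction b w) (c : ι → ℂ)
    (a : ℕ) (L : ℝ) (v : ℕ → ℂ) :
    keyWindowSesq a L v b (∑ i ∈ s, c i • f i) w = ∑ i ∈ s, c i * keyWindowSesq a L v b (f i) w := by
  classical
  induction s using Finset.induction_on with
  | empty =>
    simp only [Finset.sum_empty]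
    have h := keyWindowSesq_smul_left a L v b 0 (0 : ℝ → ℂ) w
    rw [zero_mul, zero_smul] at h
    exact h
  | insert i s hi ih =>
    rw [Finset.sum_insert hi, Finset.sum_insert hi,
      keyWindowSesq_add_left hb ((hf i (Finset.mem_insert_self i s)).smul (c i))
        (IsWindowFunction.sum s c fun j hj ↦ hf j (Finset.mem_insert_of_mem hj)) hw,
      keyWindowSesq_smul_left, ih fun j hj ↦ hf j (Finset.mem_insert_of_mem hj)]

/-- Conjugate-linearity in the second argument over finite sums of window functions (`b ≥ 0`). [folklore] -/
theorem keyWindowSesq_sum_right (hb : 0 ≤ b) {ι : Type*} (s : Finset ι) {f : ι → ℝ → ℂ}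
    (hf : ∀ j ∈ s, IsWindowFunction b (f j)) (hu : IsWindowFunction b u) (c : ι → ℂ)
    (a : ℕ) (L : ℝ) (v : ℕ → ℂ) :
    keyWindowSesq a L v b u (∑ j ∈ s, c j • f j) = ∑ j ∈ s, conj (c j) * keyWindowSesq a L v b u (f j) := by
  rw [keyWindowSesq_conj_symm, keyWindowSesq_sum_left hb s hf hu c a L v, map_sum]
  refine Finset.sum_congr rfl fun j _ ↦ ?_
  rw [map_mul, ← keyWindowSesq_conj_symm]

/-- **The Gram expansion of the Markov key form.**  For window functions `f_i` on `[-b, b]` (`b ≥ 0`) and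
coefficients `c`: `keyMarkovForm a L v b (Σ c_i f_i) = Σ_i Σ_j c_i conj(c_j) keyWindowSesq a L v b f_i f_j` (in `ℂ`).
[cite: Yoshida1992, §5 (5.13)–(5.16) (Gram form of a hermitian form on a finite basis)] -/
theorem keyMarkovForm_sum_smul (hb : 0 ≤ b) {ι : Type*} (s : Finset ι) {f : ι → ℝ → ℂ}
    (hf : ∀ i ∈ s, IsWindowFunction b (f i)) (c : ι → ℂ) (a : ℕ) (L : ℝ) (v : ℕ → ℂ) :
    ((keyMarkovForm a L v b (∑ i ∈ s, c i • f i) : ℝ) : ℂ) =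
      ∑ i ∈ s, ∑ j ∈ s, c i * conj (c j) * keyWindowSesq a L v b (f i) (f j) := by
  rw [← keyWindowSesq_self, keyWindowSesq_sum_left hb s hf (IsWindowFunction.sum s c hf) c a L v]
  refine Finset.sum_congr rfl fun i hi ↦ ?_
  rw [keyWindowSesq_sum_right hb s hf (hf i hi) c a L v, Finset.mul_sum]
  exact Finset.sum_congr rfl fun j _ ↦ by ring

/-- Real-part form of the Gram expansion. [folklore] -/
theorem keyMarkovForm_sum_smul_eq_re (hb : 0 ≤ b) {ι : Type*} (s : Finset ι) {f : ι → ℝ → ℂ}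
    (hf : ∀ i ∈ s, IsWindowFunction b (f i)) (c : ι → ℂ) (a : ℕ) (L : ℝ) (v : ℕ → ℂ) :
    keyMarkovForm a L v b (∑ i ∈ s, c i • f i) =
      (∑ i ∈ s, ∑ j ∈ s, c i * conj (c j) * keyWindowSesq a L v b (f i) (f j)).re := by
  rw [← keyMarkovForm_sum_smul hb s hf c a L v, Complex.ofReal_re]

/-- **The key form on a trigonometric section.**  For `b > 0`, a finite set of modes `s` and coefficients
`c : ℤ → ℂ`: `keyMarkovForm a L v b (Σ_{n∈s} c_nχ_n) = Re Σ_m Σ_n c_m conj(c_n) G_v(m, n)` with the SECTION GRAM MATRIX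
`G_v(m, n) = keyWindowSesq a L v b (chi b m) (chi b n)` (hermitian by `keyWindowSesq_conj_symm`; the norm is
`‖Σ c_nχ_n‖₂² = Σ |c_n|²`, the tree's `integral_norm_sq_sum_smul_chi`; for `v = χ` this is weil-grh-1's
`twistedWindowSesq χ b χ_m χ_n` by `twistedWindowSesq_eq_key`). [cite: Yoshida1992, §5 (5.13)–(5.16)] -/
theorem keyMarkovForm_sum_smul_chi (hb : 0 < b) (s : Finset ℤ) (c : ℤ → ℂ) (a : ℕ) (L : ℝ)
    (v : ℕ → ℂ) :
    keyMarkovForm a L v b (∑ n ∈ s, c n • chi b n) =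
      (∑ m ∈ s, ∑ n ∈ s, c m * conj (c n) * keyWindowSesq a L v b (chi b m) (chi b n)).re :=
  keyMarkovForm_sum_smul_eq_re hb.le s (fun n _ ↦ isWindowFunction_chi hb n) c a L v

/-! ## The polarised twisted increment through the shift pairing -/

/-- The shift pairing as a convolution: `(u ⋆ w̃)(t) = ∫ u(x+t) conj w(x) dx` (any `u`, `w`). [folklore] -/
theorem weilConv_weilReflect_eq_integral_shift_pair (u w : ℝ → ℂ) (t : ℝ) :
    weilConv u (weilReflect w) t = ∫ x : ℝ, u (x + t) * conj (w x) := by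
  rw [weilConv_apply, ← integral_add_right_eq_self (fun y : ℝ ↦ u y * weilReflect w (t - y)) t]
  refine integral_congr_ae (Eventually.of_forall fun x ↦ ?_)
  simp only [weilReflect]
  rw [show -(t - (x + t)) = x by ring]

/-- A shifted window function times the conjugate of a window function is integrable. [folklore] -/
theorem integrable_shift_mul_conj_pair (hu : IsWindowFunction b u) (hw : IsWindowFunction b w) (t : ℝ) :
    Integrable fun x ↦ u (x + t) * conj (w x) := by
  obtain ⟨S, hS0, hS⟩ := hu.bounded'
  obtain ⟨T, hT0, hT⟩ := hw.bounded'
  have hint : Integrable fun x ↦ (Icc (-b) b).indicator (fun _ ↦ S * T) x :=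
    (integrable_indicator_iff measurableSet_Icc).2 (integrableOn_const (by simp [Real.volume_Icc]))
  refine hint.mono' (((hu.measurable.comp (measurable_id.add_const t)).mul
    (Complex.continuous_conj.measurable.comp hw.measurable)).aestronglyMeasurable)
    (Eventually.of_forall fun x ↦ ?_)
  by_cases hx : x ∈ Icc (-b) b
  · rw [indicator_of_mem hx, norm_mul, Complex.norm_conj]
    exact mul_le_mul (hS _) (hT x) (norm_nonneg _) hS0
  · rw [hw.eq_zero x hx, map_zero, mul_zero, norm_zero, indicator_of_notMem hx]

/-- Conjugation preserves integrability. [folklore] -/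
private theorem integrable_conj_of_integrable {f : ℝ → ℂ} (hf : Integrable f) : Integrable fun x ↦ conj (f x) := by
  have := Complex.conjCLE.toContinuousLinearMap.integrable_comp hf
  simpa using this

/-- **The polarised twisted increment of two WINDOW functions through the shift pairings**, for every `ω ∈ ℂ`:
`D^{ω̄}_t(u, w) = (1 + |ω|²) ∫ u conj w − ω ∫ u(x+t) conj w(x) dx − ω̄ conj(∫ w(x+t) conj u(x) dx)`.
[cite: Bombieri2000Weil, Thm 2 (p. 193) (increments through the kernel)] -/
theorem weilTwistIncrementSesq_conj_of_isWindowFunction (hu : IsWindowFunction b u) (hw : IsWindowFunction b w)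
    (ω : ℂ) (t : ℝ) :
    weilTwistIncrementSesq (conj ω) u w t =
      (1 + ((‖ω‖ ^ 2 : ℝ) : ℂ)) * (∫ x : ℝ, u x * conj (w x)) - ω * (∫ x : ℝ, u (x + t) * conj (w x)) -
        conj ω * conj (∫ x : ℝ, w (x + t) * conj (u x)) := by
  have h0 : Integrable fun x ↦ u x * conj (w x) := hu.integrable_mul_conj hw
  have h1 : Integrable fun x ↦ u (x + t) * conj (w (x + t)) := h0.comp_add_right t
  have h2 : Integrable fun x ↦ ((‖ω‖ ^ 2 : ℝ) : ℂ) * (u x * conj (w x)) := h0.const_mul _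
  have h3 : Integrable fun x ↦ ω * (u (x + t) * conj (w x)) := (integrable_shift_mul_conj_pair hu hw t).const_mul ω
  have h4 : Integrable fun x ↦ conj ω * conj (w (x + t) * conj (u x)) :=
    (integrable_conj_of_integrable (integrable_shift_mul_conj_pair hw hu t)).const_mul _
  have e : ∀ x, (u (x + t) - conj ω * u x) * conj (w (x + t) - conj ω * w x) =
      u (x + t) * conj (w (x + t)) + ((‖ω‖ ^ 2 : ℝ) : ℂ) * (u x * conj (w x)) -
        ω * (u (x + t) * conj (w x)) - conj ω * conj (w (x + t) * conj (u x)) := by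
    intro x
    have hn : conj ω * ω = ((‖ω‖ ^ 2 : ℝ) : ℂ) := by rw [mul_comm, Complex.mul_conj, Complex.normSq_eq_norm_sq]
    simp only [map_sub, map_mul, Complex.conj_conj]
    rw [← hn]
    ring
  have hshift : ∫ x : ℝ, u (x + t) * conj (w (x + t)) = ∫ x : ℝ, u x * conj (w x) :=
    integral_add_right_eq_self (fun x : ℝ ↦ u x * conj (w x)) t
  have h12 : Integrable fun x ↦ u (x + t) * conj (w (x + t)) + ((‖ω‖ ^ 2 : ℝ) : ℂ) * (u x * conj (w x)) :=
    h1.add h2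
  have h123 : Integrable fun x ↦ u (x + t) * conj (w (x + t)) + ((‖ω‖ ^ 2 : ℝ) : ℂ) * (u x * conj (w x)) -
      ω * (u (x + t) * conj (w x)) := h12.sub h3
  unfold weilTwistIncrementSesq
  simp_rw [e]
  rw [integral_sub h123 h4, integral_sub h12 h3, integral_add h1 h2,
    integral_const_mul, integral_const_mul, integral_const_mul, integral_conj, hshift]
  ring

/-! ## Affinity of the sesquilinear form in the data -/

/-- **AFFINITY OF THE SESQUILINEAR KEY FORM IN THE DATA.**  For window functions `u, w` on `[-b, b]` and two data
`v, v'`: `S_v(u,w) − S_{v'}(u,w) = −Σ_{log n<2b} Λ(n)n^{-1/2}[(v(n) − v'(n))·P_{log n}(u,w) + conj(v(n) − v'(n))·conj P_{log n}(w,u)]`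
with `P_t(u, w) = ∫ u(x+t) conj w(x) dx` — the `|v(n)|²` terms of the twisted increments cancel against the killing
constant, so the sesquilinear form is AFFINE in the data.
[cite: Weil1952FormulesExplicites, (11) pp. 261–262 (the prime term is linear in χ)] -/
theorem keyWindowSesq_sub_eq (hu : IsWindowFunction b u) (hw : IsWindowFunction b w) (a : ℕ) (L : ℝ)
    (v v' : ℕ → ℂ) :
    keyWindowSesq a L v b u w - keyWindowSesq a L v' b u w =
      -∑ n ∈ weilPrimeIndex b, ((Λ n : ℝ) / Real.sqrt n : ℂ) *
        ((v n - v' n) * (∫ x : ℝ, u (x + Real.log n) * conj (w x)) +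
          conj (v n - v' n) * conj (∫ x : ℝ, w (x + Real.log n) * conj (u x))) := by
  set I : ℂ := ∫ x : ℝ, u x * conj (w x) with hI
  set P : ℕ → ℂ := fun n ↦ ∫ x : ℝ, u (x + Real.log n) * conj (w x) with hP
  set P' : ℕ → ℂ := fun n ↦ ∫ x : ℝ, w (x + Real.log n) * conj (u x) with hP'
  have hD : ∀ (z : ℕ → ℂ) (n : ℕ), weilTwistIncrementSesq (conj (z n)) u w (Real.log n) =
      (1 + ((‖z n‖ ^ 2 : ℝ) : ℂ)) * I - z n * P n - conj (z n) * conj (P' n) := fun z n ↦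
    weilTwistIncrementSesq_conj_of_isWindowFunction hu hw (z n) (Real.log n)
  have hS : ∀ z : ℕ → ℂ, ∑ n ∈ weilPrimeIndex b, ((Λ n : ℝ) / Real.sqrt n : ℂ) *
      weilTwistIncrementSesq (conj (z n)) u w (Real.log n) =
      (∑ n ∈ weilPrimeIndex b, ((Λ n : ℝ) / Real.sqrt n : ℂ) * (1 + ((‖z n‖ ^ 2 : ℝ) : ℂ))) * I -
        ∑ n ∈ weilPrimeIndex b, ((Λ n : ℝ) / Real.sqrt n : ℂ) * (z n * P n + conj (z n) * conj (P' n)) := by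
    intro z
    rw [Finset.sum_mul, ← Finset.sum_sub_distrib]
    refine Finset.sum_congr rfl fun n _ ↦ ?_
    rw [hD z n]
    ring
  have hM : ∀ z : ℕ → ℂ, (keyMarkovConstant a L z b : ℂ) =
      (∑ n ∈ weilPrimeIndex b, ((Λ n : ℝ) / Real.sqrt n : ℂ) * (1 + ((‖z n‖ ^ 2 : ℝ) : ℂ))) +
        ((2 * (∫ t in Ioi (0 : ℝ), weilKillingDensityPar a t) +
          (Real.log (4 * π) + Real.eulerMascheroniConstant - L) : ℝ) : ℂ) := by
    intro z
    unfold keyMarkovConstant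
    push_cast
    ring
  unfold keyWindowSesq
  rw [hS v, hS v', hM v, hM v']
  have hsub : ∑ n ∈ weilPrimeIndex b, ((Λ n : ℝ) / Real.sqrt n : ℂ) * (v n * P n + conj (v n) * conj (P' n)) -
      ∑ n ∈ weilPrimeIndex b, ((Λ n : ℝ) / Real.sqrt n : ℂ) * (v' n * P n + conj (v' n) * conj (P' n)) =
      ∑ n ∈ weilPrimeIndex b, ((Λ n : ℝ) / Real.sqrt n : ℂ) *
        ((v n - v' n) * P n + conj (v n - v' n) * conj (P' n)) := by
    rw [← Finset.sum_sub_distrib]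
    refine Finset.sum_congr rfl fun n _ ↦ ?_
    rw [map_sub]
    ring
  rw [← hsub]
  ring

/-- **Affinity relative to the zero key**: `S_v(u,w) = S_0(u,w) − Σ_{log n<2b} Λ(n)n^{-1/2}[v(n) P_{log n}(u,w) + conj(v(n)) conj P_{log n}(w,u)]`.
[cite: Weil1952FormulesExplicites, (11) pp. 261–262] -/
theorem keyWindowSesq_eq_zero_key_sub (hu : IsWindowFunction b u) (hw : IsWindowFunction b w) (a : ℕ) (L : ℝ)
    (v : ℕ → ℂ) :
    keyWindowSesq a L v b u w = keyWindowSesq a L 0 b u w -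
      ∑ n ∈ weilPrimeIndex b, ((Λ n : ℝ) / Real.sqrt n : ℂ) *
        (v n * (∫ x : ℝ, u (x + Real.log n) * conj (w x)) +
          conj (v n) * conj (∫ x : ℝ, w (x + Real.log n) * conj (u x))) := by
  have h := keyWindowSesq_sub_eq hu hw a L v 0
  simp only [Pi.zero_apply, sub_zero] at h
  rw [sub_eq_iff_eq_add'] at h
  rw [h]
  ring

/-! ## Gram affinity on Yoshida's windows: the matrix family `S(z)` -/

/-- **GRAM AFFINITY IN THE DATA ON THE SECTION.**  For `b > 0`, modes `m, n` and two data `v, v'`: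
`G_v(m,n) − G_{v'}(m,n) = −Σ_{log k<2b} Λ(k)k^{-1/2}[(v − v')(k)·shiftCoeff b (log k) m n + conj((v − v')(k)·shiftCoeff b (log k) n m)]`
— the section Gram family `S(z)` of the key certificates is affine in the data, with hermitian matrix coefficients
built from the closed-form shift pairings `P_t(m,n) = ∫ χ_m(x+t) conj χ_n(x) dx` of `TwistedGramEvenComplex.lean`
(weil-grh-4's `S(z) = S₀ − Σ Re z_n R_n + Σ Im z_n I_n` in complex form).
[cite: Yoshida1992, §5 (5.13)–(5.16); Weil1952FormulesExplicites, (11) pp. 261–262] -/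
theorem keyWindowSesq_chi_sub_eq (hb : 0 < b) (a : ℕ) (L : ℝ) (v v' : ℕ → ℂ) (m n : ℤ) :
    keyWindowSesq a L v b (chi b m) (chi b n) - keyWindowSesq a L v' b (chi b m) (chi b n) =
      -∑ k ∈ weilPrimeIndex b, ((Λ k : ℝ) / Real.sqrt k : ℂ) *
        ((v k - v' k) * shiftCoeff b (Real.log k) m n + conj ((v k - v' k) * shiftCoeff b (Real.log k) n m)) := by
  rw [keyWindowSesq_sub_eq (isWindowFunction_chi hb m) (isWindowFunction_chi hb n) a L v v']
  congr 1
  refine Finset.sum_congr rfl fun k hk ↦ ?_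
  have h0 : 0 ≤ Real.log k := Real.log_natCast_nonneg k
  have h2 : Real.log k ≤ 2 * b := (mem_weilPrimeIndex.1 hk).le
  rw [← shiftCoeff_eq_integral hb m n h0 h2, ← shiftCoeff_eq_integral hb n m h0 h2, map_mul]

/-- The same relative to the zero key:
`G_v(m,n) = G_0(m,n) − Σ_{log k<2b} Λ(k)k^{-1/2}[v(k)·P_{log k}(m,n) + conj(v(k)·P_{log k}(n,m))]`. [folklore] -/
theorem keyWindowSesq_chi_eq_zero_key_sub (hb : 0 < b) (a : ℕ) (L : ℝ) (v : ℕ → ℂ) (m n : ℤ) :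
    keyWindowSesq a L v b (chi b m) (chi b n) = keyWindowSesq a L 0 b (chi b m) (chi b n) -
      ∑ k ∈ weilPrimeIndex b, ((Λ k : ℝ) / Real.sqrt k : ℂ) *
        (v k * shiftCoeff b (Real.log k) m n + conj (v k * shiftCoeff b (Real.log k) n m)) := by
  have h := keyWindowSesq_chi_sub_eq hb a L v 0 m n
  simp only [Pi.zero_apply, sub_zero] at h
  rw [sub_eq_iff_eq_add'] at h
  rw [h]
  ring

end Summit.Ventures.WeilGRH

end
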